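import Summits.HubbardSuperconductivity.HubbardSuperconductivity.Theorems.CooperPairDMottWalkPlaquetteTables
import Summits.HubbardSuperconductivity.HubbardSuperconductivity.Theorems.CooperPairDMottWalkCooperPairDMottPlaquetteGCWindowAlgebra

/-!
# Route `CooperPairDMottWalk`, crux `CooperPairDMott`: all sectors of the plaquette, transport

Helper file for the stub `stub_plaquetteGCWindow` (item stmt-HubbardSuperconductivity-1177). The
grand-canonical window needs a lower bound of the plaquette form `Re⟨v, H(U) v⟩` on EVERY sector
`(N↑, N↓) = (a, b)`, `a, b ∈ {0, …, 4}`; this file completes the sector tables of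
`…PlaquetteTables` (enumerations `s0`, `s3`, `s4` of the `0`-, `3`-, `4`-subsets of `Fin 4`, the
three-fermion hopping table `K3`, the trivial table `Kz`), and transports real-form lower bounds of
the computable `Fin 4` model to the plaquette `plaquetteHamiltonian U = Γ H₄(U) Γᴴ`:

* `sector_form_lb`: `(∀ x, lam‖x‖² ≤ hopR Ka Kb x + U dblR d x) → lam‖v‖² ≤ Re⟨v, H(U) v⟩` for
  every plaquette vector `v` of the sector `(a, b)` (Lieb coordinates of `Γᴴ v`, real and imaginary
  parts separately);
* `plaquette22_rankOne_bound`: the same for the DEFLATED `(2,2)` bound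
  `m‖x‖² ≤ form(x) + P (u·x)²`, whose complex form is `m‖w‖² ≤ Re⟨w, H w⟩ + P |⟨Γ û, w⟩|²` with
  `û = intVec22 u` the sector vector of the integer array `u`.

Sources: E. H. Lieb, PRL 62 (1989) 1201, eq. (4); Bratteli–Robinson II, Thm. 5.2.5 (relabelling).
All statements are [folklore]; the tables are a finite computation (`decide`).
-/

set_option linter.dupNamespace false

noncomputable section

namespace Summit.HubbardSuperconductivity.HubbardSuperconductivity.Theorems.CooperPairDMottWalk

open Literature.MathematicalPhysics.QuantumLattice Literature.MathematicalPhysics.QuantumLattice.TwoSpecies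
open Matrix Finset
open scoped ComplexOrder

/-! ### The remaining enumerations and tables -/

/-- Enumeration of the `0`-subsets of `Fin 4` (the empty set). [folklore] -/
def s0 : Fin 1 → Finset (Fin 4) := ![∅]

/-- Enumeration of the `3`-subsets of `Fin 4` (lexicographic). [folklore] -/
def s3 : Fin 4 → Finset (Fin 4) := ![{0, 1, 2}, {0, 1, 3}, {0, 2, 3}, {1, 2, 3}]

/-- Enumeration of the `4`-subsets of `Fin 4` (the full set). [folklore] -/
def s4 : Fin 1 → Finset (Fin 4) := ![{0, 1, 2, 3}]

/-- `s0` enumerates the `0`-subsets. [folklore] -/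
theorem isSubsetEnum_s0 : IsSubsetEnum 0 s0 where
  inj i j _ := Subsingleton.elim i j
  image_eq := by decide +kernel

/-- `s3` enumerates the `3`-subsets. [folklore] -/
theorem isSubsetEnum_s3 : IsSubsetEnum 3 s3 where
  inj i j h := (by decide : ∀ i j : Fin 4, s3 i = s3 j → i = j) i j h
  image_eq := by decide +kernel

/-- `s4` enumerates the `4`-subsets. [folklore] -/
theorem isSubsetEnum_s4 : IsSubsetEnum 4 s4 where
  inj i j _ := Subsingleton.elim i j
  image_eq := by decide +kernel

/-- `K₃`: the hopping matrix of three fermions (one hole) on the 4-cycle in the enumeration `s3`,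
with Jordan–Wigner signs. [folklore] -/
def K3 : Fin 4 → Fin 4 → ℤ := ![![0, -1, 1, 0], ![-1, 0, 0, 1], ![1, 0, 0, -1], ![0, 1, -1, 0]]

/-- The trivial `1 × 1` hopping table of the sectors with `0` or `4` fermions of one species. [folklore] -/
def Kz : Fin 1 → Fin 1 → ℤ := fun _ _ => 0

/-- The table `K₃` is the hopping matrix between three-element subsets. [folklore] -/
theorem hopInt_s3 : ∀ i j : Fin 4, hopInt plaqGraph4 (s3 i) (s3 j) = -K3 i j := by
  decide +kernel

/-- No hopping out of the empty configuration. [folklore] -/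
theorem hopInt_s0 : ∀ i j : Fin 1, hopInt plaqGraph4 (s0 i) (s0 j) = -Kz i j := by
  decide +kernel

/-- No hopping out of the full configuration. [folklore] -/
theorem hopInt_s4 : ∀ i j : Fin 1, hopInt plaqGraph4 (s4 i) (s4 j) = -Kz i j := by
  decide +kernel

/-- Hopping entries between three-element subsets. [folklore] -/
theorem hoppingMatrix_s3 (i j : Fin 4) :
    hoppingMatrix plaqGraph4 1 (s3 i) (s3 j) = (K3 i j : ℂ) := by
  rw [hoppingMatrix_eq_cast, hopInt_s3]; push_cast; ring

/-- Hopping entries between `0`-subsets. [folklore] -/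
theorem hoppingMatrix_s0 (i j : Fin 1) :
    hoppingMatrix plaqGraph4 1 (s0 i) (s0 j) = (Kz i j : ℂ) := by
  rw [hoppingMatrix_eq_cast, hopInt_s0]; push_cast; ring

/-- Hopping entries between `4`-subsets. [folklore] -/
theorem hoppingMatrix_s4 (i j : Fin 1) :
    hoppingMatrix plaqGraph4 1 (s4 i) (s4 j) = (Kz i j : ℂ) := by
  rw [hoppingMatrix_eq_cast, hopInt_s4]; push_cast; ring

/-! ### Transport of real-form lower bounds to the plaquette -/

/-- Pull-back of the plaquette form along `Γᴴ`: `⟨Γᴴv, H₄ Γᴴv⟩ = ⟨v, H v⟩` and `‖Γᴴ v‖ = ‖v‖`. [folklore] -/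
theorem form_pull (U : ℝ) (v : Fock (Orb PlaquetteSite)) :
    star (gamᴴ *ᵥ v) ⬝ᵥ (ham4 U *ᵥ (gamᴴ *ᵥ v)) = star v ⬝ᵥ (plaquetteHamiltonian U *ᵥ v) ∧
      star (gamᴴ *ᵥ v) ⬝ᵥ (gamᴴ *ᵥ v) = star v ⬝ᵥ v := by
  rw [ham4_mulVec_pull, star_conjTranspose_relabelMatrix_mulVec_dotProduct,
    star_conjTranspose_relabelMatrix_mulVec_dotProduct]
  exact ⟨rfl, rfl⟩

/-- **Sector form bounds transport to the plaquette.** If the real sector form of the `Fin 4` model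
in the sector `(a, b)` (enumerations `sa`, `sb`, tables `Ka`, `Kb`, `d`) is bounded below by `lam`,
then `lam‖v‖² ≤ Re⟨v, H(U) v⟩` for every plaquette vector `v` of the sector `(a, b)`. [folklore] -/
theorem sector_form_lb {a b p q : ℕ} {sa : Fin p → Finset (Fin 4)} {sb : Fin q → Finset (Fin 4)}
    (ha : IsSubsetEnum a sa) (hb : IsSubsetEnum b sb)
    {Ka : Fin p → Fin p → ℤ} {Kb : Fin q → Fin q → ℤ} {d : Fin p → Fin q → ℕ}
    (hKa : ∀ i i', hoppingMatrix plaqGraph4 1 (sa i) (sa i') = (Ka i i' : ℂ))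
    (hKb : ∀ j j', hoppingMatrix plaqGraph4 1 (sb j) (sb j') = (Kb j j' : ℂ))
    (hd : ∀ i j, (sa i ∩ sb j).card = d i j) {U lam : ℝ}
    (h : ∀ x : Fin p → Fin q → ℝ, lam * nsqR x ≤ hopR Ka Kb x + U * dblR d x)
    (v : Fock (Orb PlaquetteSite)) (hv : IsInSector a b v) :
    lam * (star v ⬝ᵥ v).re ≤ (star v ⬝ᵥ (plaquetteHamiltonian U *ᵥ v)).re := by
  obtain ⟨hform, hnorm⟩ := form_pull U v
  set ψ := gamᴴ *ᵥ v with hψdef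
  have hψ : IsInSector a b ψ := isInSector_conjTranspose_relabelMatrix_mulVec siteEquiv hv
  rw [← hform, ← hnorm, re_sector_norm_eq ha hb hψ,
    re_sector_hamiltonian_eq plaqGraph4 ha hb 1 U hKa hKb hd hψ]
  set W : Fin p → Fin q → ℂ := fun i j => coeffMatrix ψ (sa i) (sb j) with hW
  rw [normSqW_eq_nsqR, hopForm_eq_hopR, dblForm_eq_dblR]
  have h1 := h (fun i j => (W i j).re)
  have h2 := h (fun i j => (W i j).im)
  linarith

/-! ### The deflated bound of the sector `(2,2)` -/

/-- The `(2,2)`-sector vector of the `Fin 4` model with integer coordinate array `u`. [folklore] -/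
def intVec22 (u : Fin 6 → Fin 6 → ℤ) : Fock (Orb (Fin 4)) :=
  ofSectorArray s2 s2 fun i j => ((u i j : ℤ) : ℂ)

/-- `intVec22 u` lies in the sector `(2,2)`. [folklore] -/
theorem isInSector_intVec22 (u : Fin 6 → Fin 6 → ℤ) : IsInSector 2 2 (intVec22 u) :=
  isInSector_ofSectorArray isSubsetEnum_s2 isSubsetEnum_s2 _

/-- `⟨û, ψ⟩ = Σ u_{ij} w22(ψ)_{ij}` for `ψ` arbitrary. [folklore] -/
theorem star_intVec22_dotProduct (u : Fin 6 → Fin 6 → ℤ) (ψ : Fock (Orb (Fin 4))) :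
    star (intVec22 u) ⬝ᵥ ψ = ∑ i, ∑ j, (u i j : ℂ) * w22 ψ i j := by
  rw [sector_star_dotProduct isSubsetEnum_s2 isSubsetEnum_s2 (isInSector_intVec22 u) ψ]
  refine Finset.sum_congr rfl fun i _ => Finset.sum_congr rfl fun j _ => ?_
  rw [intVec22, coeffMatrix_ofSectorArray isSubsetEnum_s2 isSubsetEnum_s2, w22]
  simp

/-- Real and imaginary parts of `⟨û, ψ⟩`. [folklore] -/
theorem star_intVec22_dotProduct_re_im (u : Fin 6 → Fin 6 → ℤ) (ψ : Fock (Orb (Fin 4))) :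
    (star (intVec22 u) ⬝ᵥ ψ).re = dotZR u (fun i j => (w22 ψ i j).re) ∧
      (star (intVec22 u) ⬝ᵥ ψ).im = dotZR u (fun i j => (w22 ψ i j).im) := by
  rw [star_intVec22_dotProduct]
  constructor
  · simp only [dotZR, Complex.re_sum, Complex.mul_re, Complex.intCast_re, Complex.intCast_im, zero_mul,
      sub_zero]
  · simp only [dotZR, Complex.im_sum, Complex.mul_im, Complex.intCast_re, Complex.intCast_im, zero_mul,
      add_zero]

/-- **The deflated `(2,2)` bound in the `Fin 4` model**: a real bound
`m‖x‖² ≤ hopR x + U dblR x + P (u·x)²` gives `m‖ψ‖² ≤ Re⟨ψ, H₄ ψ⟩ + P |⟨û, ψ⟩|²` on the sector. [folklore] -/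
theorem sector22_rankOne_bound {U m P : ℝ} {u : Fin 6 → Fin 6 → ℤ}
    (h : ∀ x : Fin 6 → Fin 6 → ℝ, m * nsqR x ≤ hopR K2 K2 x + U * dblR d22 x + P * dotZR u x ^ 2)
    (ψ : Fock (Orb (Fin 4))) (hψ : IsInSector 2 2 ψ) :
    m * (star ψ ⬝ᵥ ψ).re ≤ (star ψ ⬝ᵥ (ham4 U *ᵥ ψ)).re + P * ‖star (intVec22 u) ⬝ᵥ ψ‖ ^ 2 := by
  obtain ⟨hn, hH⟩ := sector22_forms U hψ
  obtain ⟨hre, him⟩ := star_intVec22_dotProduct_re_im u ψ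
  rw [hn, hH, normSqW_eq_nsqR, hopForm_eq_hopR, dblForm_eq_dblR, Complex.sq_norm, Complex.normSq_apply,
    hre, him]
  have h1 := h (fun i j => (w22 ψ i j).re)
  have h2 := h (fun i j => (w22 ψ i j).im)
  nlinarith

/-- `⟨Γ û, w⟩ = ⟨û, Γᴴ w⟩`. [folklore] -/
theorem star_gam_mulVec_dotProduct (φ : Fock (Orb (Fin 4))) (w : Fock (Orb PlaquetteSite)) :
    star (gam *ᵥ φ) ⬝ᵥ w = star φ ⬝ᵥ (gamᴴ *ᵥ w) := by
  rw [star_mulVec, ← dotProduct_mulVec]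

/-- **The deflated `(2,2)` bound on the plaquette**: `m‖w‖² ≤ Re⟨w, H(U) w⟩ + P |⟨Γ û, w⟩|²` for every
plaquette vector `w` of the sector `(2,2)`. [folklore] -/
theorem plaquette22_rankOne_bound {U m P : ℝ} {u : Fin 6 → Fin 6 → ℤ}
    (h : ∀ x : Fin 6 → Fin 6 → ℝ, m * nsqR x ≤ hopR K2 K2 x + U * dblR d22 x + P * dotZR u x ^ 2)
    (w : Fock (Orb PlaquetteSite)) (hw : IsInSector 2 2 w) :
    m * (star w ⬝ᵥ w).re ≤ (star w ⬝ᵥ (plaquetteHamiltonian U *ᵥ w)).re +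
      P * ‖star (gam *ᵥ intVec22 u) ⬝ᵥ w‖ ^ 2 := by
  obtain ⟨hform, hnorm⟩ := form_pull U w
  rw [← hform, ← hnorm, star_gam_mulVec_dotProduct]
  exact sector22_rankOne_bound h _ (isInSector_conjTranspose_relabelMatrix_mulVec siteEquiv hw)

/-! ### Small helpers at the plaquette level -/

/-- `Re ‖v‖² ≥ 0`. [folklore] -/
theorem normSq_re_nonneg (v : Fock (Orb PlaquetteSite)) : 0 ≤ (star v ⬝ᵥ v).re :=
  (Complex.nonneg_iff.1 (dotProduct_star_self_nonneg v)).1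

/-- Weakening the constant of a form bound. [folklore] -/
theorem formBound_weaken {U c lam : ℝ} {v : Fock (Orb PlaquetteSite)} (hle : c ≤ lam)
    (h : lam * (star v ⬝ᵥ v).re ≤ (star v ⬝ᵥ (plaquetteHamiltonian U *ᵥ v)).re) :
    c * (star v ⬝ᵥ v).re ≤ (star v ⬝ᵥ (plaquetteHamiltonian U *ᵥ v)).re :=
  le_trans (mul_le_mul_of_nonneg_right hle (normSq_re_nonneg v)) h

/-! ### Registered sub-goal of the crux item (stmt-HubbardSuperconductivity-1177) -/

set_option linter.style.longLine false in
/-- Registered sub-goal `plaquetteGCWindow_sectorFormLb` of the crux item: transport of real sector-form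
lower bounds of the `Fin 4` model to the plaquette (`sector_form_lb`, closed restatement). [folklore] -/
theorem plaquetteGCWindow_sectorFormLb : ∀ {a b p q : ℕ} {sa : Fin p → Finset (Fin 4)} {sb : Fin q → Finset (Fin 4)}, IsSubsetEnum a sa → IsSubsetEnum b sb → ∀ {Ka : Fin p → Fin p → ℤ} {Kb : Fin q → Fin q → ℤ} {d : Fin p → Fin q → ℕ}, (∀ i i', hoppingMatrix plaqGraph4 1 (sa i) (sa i') = (Ka i i' : ℂ)) → (∀ j j', hoppingMatrix plaqGraph4 1 (sb j) (sb j') = (Kb j j' : ℂ)) → (∀ i j, (sa i ∩ sb j).card = d i j) → ∀ {U lam : ℝ}, (∀ x : Fin p → Fin q → ℝ, lam * nsqR x ≤ hopR Ka Kb x + U * dblR d x) → ∀ v : Fock (Orb (FermionTorus 2 2)), IsInSector a b v → lam * (star v ⬝ᵥ v).re ≤ (star v ⬝ᵥ (hubbardTorus 2 2 1 U *ᵥ v)).re :=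
  sector_form_lb

end Summit.HubbardSuperconductivity.HubbardSuperconductivity.Theorems.CooperPairDMottWalk

end
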